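import Literature.MathematicalPhysics.QuantumLattice.BdGBondHamiltonianFreeEnergyBounds
import Summits.HubbardSuperconductivity.HubbardSuperconductivity.Theorems.BalabanIRBirGappedPhaseReductionTraceHolder
import HarnessLib

/-!
# Route BalabanIR — crux 4 `BirGappedPhaseReduction` (item `stmt-HubbardSuperconductivity-2082`): the fermionic-weight half of the coercivity dictionary

The route's reduction must land the fermion-induced phase action INSIDE a coercive class: the
modulus of the quasi-free fermionic weight of a space-time pair-phase configuration has to carry
one small factor `e^{-κ R(θ_τ)}` per misaligned time slice. The route text (docstring of crux 3
`BirBdGPhaseCoercivity`, ROLE ¶; crux 4 step (2), coercivity (C) = "crux 3 + Hölder") obtains this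
from two ingredients:

1. the TRACE HÖLDER inequality `‖Tr ∏_τ e^{-aH_τ}‖ ≤ ∏_τ (Tr e^{-MaH_τ})^{1/M}` — in the tree as
   `norm_trace_prod_exp_le_exp_sub_sum` (`…TraceHolder.lean`, dyadic `M = 2^{k+1}`);
2. the identification of the slice free energy with the quasi-free (BdG) ground-state energy,
   `e^{-βE_qf(θ)} ≤ Tr e^{-βH_BdG(θ)} ≤ 4^{|Λ|} e^{-βE_qf(θ)}`,
   `E_qf(θ) = Σ_x(Re τ(x,x) - μ) - ½ Σ_i |λ_i(𝓗(θ))|` — in the tree as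
   `exp_le_re_partitionFn_bdgBondHamiltonian` / `re_partitionFn_bdgBondHamiltonian_le`
   (`Literature/…/BdGBondHamiltonianFreeEnergyBounds.lean`, via Lieb's partial particle–hole
   transformation, `BdGBondHamiltonianParticleHole.lean`), where `𝓗(θ) = bdgNambuMatrix τ (Δ θ) μ`
   is de Gennes' BdG matrix `fromBlocks (τ-μ) D Dᴴ (-(τ-μ)ᵀ)` (`bdgNambuMatrix_eq_reindex_fromBlocks`).

This file composes them. For the second-quantised BdG Hamiltonian `H(θ) = bdgBondHamiltonian τ (Δ θ) μ`
with Hermitian hopping `τ`, ANY finite orbital set, and a family of pairing data `Δ θ`: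

* `re_partitionFn_bdg_le_of_coercive` — **one slice**: a static phase-rigidity bound of the shape
  of crux 3, `c₀ S ≤ Σ_i|λ_i(𝓗(θ₀))| - Σ_i|λ_i(𝓗(θ))|`, gives
  `Tr e^{-βH(θ)} ≤ 4^{|Λ|} e^{-βc₀S/2} Tr e^{-βH(θ₀)}` (`β ≥ 0`);
* `norm_trace_prod_gibbs_bdg_le_of_coercive` — **`M = 2^{k+1}` slices** (Trotter step `a ≥ 0`):
  if every slice obeys `c₀ S_τ ≤ Σ_i|λ_i(𝓗(θ₀))| - Σ_i|λ_i(𝓗(θ_τ))|`, then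
  **`‖Tr ∏_τ e^{-aH(θ_τ)}‖ ≤ 4^{|Λ|} · e^{-(a c₀/2) Σ_τ S_τ} · Tr e^{-Ma H(θ₀)}`** —
  the fermionic weight of the space-time configuration relative to the aligned reference carries
  the coercive factor, up to the slice-independent entropy factor `4^{|Λ|}` (the price of Hölder at
  the level of traces; removing it is the business of the multiscale expansion, not of this step).

Instantiation for crux 3 as typed (`BirBdGPhaseCoercivity`, matrices on `TorusSite 2 L ⊕ TorusSite 2 L`):
take `Λ = FermionTorus 2 L`, transport `h = -adjacency - μ` and the `d+id` bond pairing `D(θ)` along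
`FermionTorus.equivTorusSite`, put `Δ θ := -½ · conj ∘ D(θ)` (so that `-(Δ + Δᵀ)ᴴ… = D(θ)`,
`D` symmetric, `h` real symmetric), and move `Σ_i|λ_i|` across the relabelling with
`sum_abs_eigenvalues_reindex` (`charpoly` is reindex-invariant). No definition is introduced; the
file is `Theses`-free (imports Literature + the `Theses`-free `…TraceHolder`).

References: B. Simon, *Trace Ideals and Their Applications* (2005), Thm 2.8 (Hölder);
V. Bach, E. H. Lieb, J. P. Solovej, J. Stat. Phys. 76 (1994) 3, §2–3 (quasi-free energy with
pairing via the particle–hole transformation); P. G. de Gennes (1966) Ch. 5.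
-/

noncomputable section

namespace Summit.HubbardSuperconductivity.HubbardSuperconductivity.Theorems

open Matrix NormedSpace Literature.MathematicalPhysics.QuantumLattice
open scoped ComplexOrder

variable {Λ : Type*} [LinearOrder Λ] [Fintype Λ]

/-- **One slice of the coercivity dictionary.** If the quasi-free energies of the pairing data
`Δ` and of the reference `Δ₀` obey the static rigidity bound
`c₀ S ≤ Σ_i|λ_i(𝓗(Δ₀))| - Σ_i|λ_i(𝓗(Δ))|` (the shape of crux 3 `BirBdGPhaseCoercivity`), then for
`β ≥ 0` the slice partition functions obey `Tr e^{-βH_BdG(Δ)} ≤ 4^{|Λ|} e^{-βc₀S/2} Tr e^{-βH_BdG(Δ₀)}`.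
[cite: BachLiebSolovej1994, Theorem 2.3] -/
theorem re_partitionFn_bdg_le_of_coercive {τ : Λ → Λ → ℂ} (hτ : ∀ x y, star (τ x y) = τ y x)
    (Δ Δ₀ : Λ → Λ → ℂ) (μ : ℝ) {c₀ S : ℝ}
    (hcoer : c₀ * S ≤ ∑ i, |(isHermitian_bdgNambuMatrix hτ Δ₀ μ).eigenvalues i| -
        ∑ i, |(isHermitian_bdgNambuMatrix hτ Δ μ).eigenvalues i|)
    {β : ℝ} (hβ : 0 ≤ β) :
    (partitionFn β (bdgBondHamiltonian τ Δ μ)).re ≤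
      4 ^ Fintype.card Λ * Real.exp (-(β * c₀ * S / 2)) *
        (partitionFn β (bdgBondHamiltonian τ Δ₀ μ)).re := by
  set C : ℝ := ∑ x : Λ, ((τ x x).re - μ) with hC
  set T : ℝ := ∑ i, |(isHermitian_bdgNambuMatrix hτ Δ μ).eigenvalues i| with hT
  set T₀ : ℝ := ∑ i, |(isHermitian_bdgNambuMatrix hτ Δ₀ μ).eigenvalues i| with hT₀
  have hup := re_partitionFn_bdgBondHamiltonian_le hτ Δ μ hβ
  have hlow := exp_le_re_partitionFn_bdgBondHamiltonian hτ Δ₀ μ β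
  rw [← hC, ← hT] at hup
  rw [← hC, ← hT₀] at hlow
  have hexp : Real.exp (-β * (C - T / 2)) ≤
      Real.exp (-(β * c₀ * S / 2)) * Real.exp (-β * (C - T₀ / 2)) := by
    rw [← Real.exp_add, Real.exp_le_exp]
    nlinarith [mul_nonneg hβ (sub_nonneg.2 hcoer)]
  calc (partitionFn β (bdgBondHamiltonian τ Δ μ)).re
      ≤ 4 ^ Fintype.card Λ * Real.exp (-β * (C - T / 2)) := hup
    _ ≤ 4 ^ Fintype.card Λ * (Real.exp (-(β * c₀ * S / 2)) * Real.exp (-β * (C - T₀ / 2))) :=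
        mul_le_mul_of_nonneg_left hexp (by positivity)
    _ ≤ 4 ^ Fintype.card Λ * (Real.exp (-(β * c₀ * S / 2)) *
          (partitionFn β (bdgBondHamiltonian τ Δ₀ μ)).re) :=
        mul_le_mul_of_nonneg_left (mul_le_mul_of_nonneg_left hlow (Real.exp_pos _).le)
          (by positivity)
    _ = 4 ^ Fintype.card Λ * Real.exp (-(β * c₀ * S / 2)) *
          (partitionFn β (bdgBondHamiltonian τ Δ₀ μ)).re := by ring

/-- **The fermionic-weight half of the coercivity dictionary** (`M = 2^{k+1}` Trotter slices of
width `a ≥ 0`). If every slice's pairing data `Δ_τ` obeys the static rigidity bound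
`c₀ S_τ ≤ Σ_i|λ_i(𝓗(Δ₀))| - Σ_i|λ_i(𝓗(Δ_τ))|` against a common reference `Δ₀` (crux 3's shape, `S_τ`
the misalignment functional of slice `τ`), then the modulus of the quasi-free fermionic weight of
the space-time configuration is bounded by the aligned reference weight times one coercive factor
per slice: `‖Tr ∏_τ e^{-aH_BdG(Δ_τ)}‖ ≤ 4^{|Λ|} e^{-(ac₀/2)Σ_τ S_τ} Tr e^{-MaH_BdG(Δ₀)}`
(Hölder `norm_trace_prod_exp_le_exp_sub_sum` + the quasi-free free-energy bounds).
[cite: Simon2005TraceIdeals, Theorem 2.8] -/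
theorem norm_trace_prod_gibbs_bdg_le_of_coercive {τ : Λ → Λ → ℂ}
    (hτ : ∀ x y, star (τ x y) = τ y x) (μ : ℝ) (k : ℕ) {a : ℝ} (ha : 0 ≤ a)
    (Δ : Fin (2 ^ (k + 1)) → (Λ → Λ → ℂ)) (Δ₀ : Λ → Λ → ℂ) {c₀ : ℝ} (S : Fin (2 ^ (k + 1)) → ℝ)
    (hcoer : ∀ i, c₀ * S i ≤ ∑ j, |(isHermitian_bdgNambuMatrix hτ Δ₀ μ).eigenvalues j| -
        ∑ j, |(isHermitian_bdgNambuMatrix hτ (Δ i) μ).eigenvalues j|) :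
    ‖(List.ofFn fun i => exp (-(a : ℂ) • bdgBondHamiltonian τ (Δ i) μ)).prod.trace‖ ≤
      4 ^ Fintype.card Λ * Real.exp (-(a * c₀ / 2 * ∑ i, S i)) *
        (partitionFn (((2 ^ (k + 1) : ℕ) : ℝ) * a) (bdgBondHamiltonian τ Δ₀ μ)).re := by
  set C : ℝ := ∑ x : Λ, ((τ x x).re - μ) with hC
  set T : Fin (2 ^ (k + 1)) → ℝ := fun i =>
    ∑ j, |(isHermitian_bdgNambuMatrix hτ (Δ i) μ).eigenvalues j| with hT
  set T₀ : ℝ := ∑ j, |(isHermitian_bdgNambuMatrix hτ Δ₀ μ).eigenvalues j| with hT₀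
  set Mr : ℝ := ((2 ^ (k + 1) : ℕ) : ℝ) with hMr
  set Lg : ℝ := (Fintype.card Λ : ℝ) * Real.log 4 with hLg
  have hMr2 : Mr = (2 : ℝ) ^ (k + 1) := by rw [hMr]; push_cast; ring
  have hMr0 : Mr ≠ 0 := by rw [hMr2]; positivity
  have hMa : 0 ≤ Mr * a := by rw [hMr2]; positivity
  have h4 : Real.exp Lg = 4 ^ Fintype.card Λ := by
    rw [hLg, Real.exp_nat_mul, Real.exp_log (by norm_num : (0 : ℝ) < 4)]
  -- the slices
  set H : Fin (2 ^ (k + 1)) → Matrix (Finset (Orb Λ)) (Finset (Orb Λ)) ℂ :=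
    fun i => bdgBondHamiltonian τ (Δ i) μ with hH
  have hHi : ∀ i, (H i).IsHermitian := fun i => isHermitian_bdgBondHamiltonian hτ (Δ i) μ
  set G : Fin (2 ^ (k + 1)) → Matrix (Finset (Orb Λ)) (Finset (Orb Λ)) ℂ :=
    fun i => -(a : ℂ) • H i with hG
  have hGi : ∀ i, (G i).IsHermitian := by
    intro i
    have h := isHermitian_real_smul (hHi i) (-a)
    rwa [Complex.ofReal_neg] at h
  have hsmul : ∀ i, (2 ^ (k + 1)) • G i = (-((Mr * a : ℝ) : ℂ)) • H i := by
    intro i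
    rw [hG, ← Nat.cast_smul_eq_nsmul ℂ, smul_smul, hMr]
    congr 1
    push_cast
    ring
  -- per-slice free-energy exponents
  set b : Fin (2 ^ (k + 1)) → ℝ := fun i => -a * (C - T i / 2) + Lg / Mr with hb
  have hbexp : ∀ i, Real.exp (2 ^ (k + 1) * b i) =
      4 ^ Fintype.card Λ * Real.exp (-(Mr * a) * (C - T i / 2)) := by
    intro i
    rw [hb, ← hMr2, mul_add, mul_div_cancel₀ _ hMr0, Real.exp_add, h4]
    ring_nf
  have hbi : ∀ i, ((exp ((2 ^ (k + 1)) • G i)).trace).re ≤ Real.exp (2 ^ (k + 1) * b i) := by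
    intro i
    rw [hsmul, hbexp]
    have h := re_partitionFn_bdgBondHamiltonian_le hτ (Δ i) μ hMa
    rw [← hC] at h
    exact h
  -- rigidity of the exponents
  have hR : ∀ i, b i ≤ (-a * (C - T₀ / 2) + Lg / Mr) - (a * c₀ / 2) * S i := by
    intro i
    have hc : c₀ * S i ≤ T₀ - T i := hcoer i
    change -a * (C - T i / 2) + Lg / Mr ≤ (-a * (C - T₀ / 2) + Lg / Mr) - (a * c₀ / 2) * S i
    nlinarith [mul_nonneg ha (sub_nonneg.2 hc)]
  have hmain := norm_trace_prod_exp_le_exp_sub_sum k G hGi b hbi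
    (-a * (C - T₀ / 2) + Lg / Mr) (a * c₀ / 2) S hR
  -- the reference slice from below
  have hlow : Real.exp (2 ^ (k + 1) * (-a * (C - T₀ / 2) + Lg / Mr)) ≤
      4 ^ Fintype.card Λ * (partitionFn (Mr * a) (bdgBondHamiltonian τ Δ₀ μ)).re := by
    rw [← hMr2, mul_add, mul_div_cancel₀ _ hMr0, Real.exp_add, h4, mul_comm]
    refine mul_le_mul_of_nonneg_left ?_ (by positivity)
    have h := exp_le_re_partitionFn_bdgBondHamiltonian hτ Δ₀ μ (Mr * a)
    rw [← hC, ← hT₀] at h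
    refine le_of_eq_of_le ?_ h
    congr 1
    ring
  calc ‖(List.ofFn fun i => exp (-(a : ℂ) • bdgBondHamiltonian τ (Δ i) μ)).prod.trace‖
      = ‖(List.ofFn fun i => exp (G i)).prod.trace‖ := rfl
    _ ≤ Real.exp (2 ^ (k + 1) * (-a * (C - T₀ / 2) + Lg / Mr)) *
          Real.exp (-(a * c₀ / 2 * ∑ i, S i)) := hmain
    _ ≤ 4 ^ Fintype.card Λ * (partitionFn (Mr * a) (bdgBondHamiltonian τ Δ₀ μ)).re *
          Real.exp (-(a * c₀ / 2 * ∑ i, S i)) :=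
        mul_le_mul_of_nonneg_right hlow (Real.exp_pos _).le
    _ = 4 ^ Fintype.card Λ * Real.exp (-(a * c₀ / 2 * ∑ i, S i)) *
          (partitionFn (Mr * a) (bdgBondHamiltonian τ Δ₀ μ)).re := by ring

end Summit.HubbardSuperconductivity.HubbardSuperconductivity.Theorems

end
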